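import Mathlib

/-!
# Unramified: a uniformiser of the base stays a uniformiser, and the ring of integers is a DVR

Blind cell `pub-hodge-repro2`, seat p8 (gen 13), Tier-5 kernel support.  The inert-place Hecke
package (`T5CartanUnitaryThree`, `T5UnitaryThreeHecke`) takes a DVR `R` (the ring of integers of
`E_v`) and an element `ϖ : R` that is IRREDUCIBLE IN `R` and fixed by the star.  In the record
`ϖ` is a uniformiser of the base field `F_v` and `E_v / F_v` is UNRAMIFIED, i.e. `e = 1`:
`𝔭_{F_v} 𝒪_{E_v} = 𝔭_{E_v}`.  This file is that reading, with the ramification index of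
Mathlib (`Ideal.ramificationIdx'`) on both sides:

* `map_maximalIdeal_eq_span` — `𝔭_{R₀} R = (ϖ)` for any irreducible `ϖ` of the DVR `R₀`;
* `irreducible_algebraMap_of_map_eq` — `𝔭_{R₀} R = 𝔭_R` ⇒ `ϖ` is irreducible in the DVR `R`;
* `ramificationIdx'_eq_one_of_map_eq` / `map_eq_of_ramificationIdx'_eq_one` — for DVRs the
  condition `𝔭_{R₀} R = 𝔭_R` is `ramificationIdx' 𝔭_{R₀} 𝔭_R = 1` (given `𝔭_{R₀} R ≠ ⊥` and
  `𝔭_{R₀} R ≤ 𝔭_R`);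
* `irreducible_algebraMap_of_ramificationIdx'_eq_one` — `e = 1` ⇒ `ϖ` irreducible in `R`;
* `not_isField_integralClosure` / `isDiscreteValuationRing_integralClosure` — for a DVR `R₀`
  with fraction field `F` and a finite separable extension `E / F`, the integral closure of `R₀`
  in `E` is a DVR as soon as it is LOCAL (Mathlib's `integralClosure.isDedekindDomain` and
  `IsDiscreteValuationRing.TFAE`): the reading «`𝒪_{E_v}` is a DVR» reduces to «`𝒪_{E_v}` is
  local», i.e. to the uniqueness of the prime above `𝔭_{F_v}`.

README §8(d): uses an L-value-free non-vanishing device: NO.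
-/

namespace Summit.Ventures.HodgeRepro2.T5UnramifiedUniformiser

open IsLocalRing

section DVR

variable {R₀ R : Type*} [CommRing R₀] [IsDomain R₀] [IsDiscreteValuationRing R₀]
  [CommRing R] [IsDomain R] [IsDiscreteValuationRing R] [Algebra R₀ R]

omit [IsDomain R] [IsDiscreteValuationRing R] in
/-- `𝔭_{R₀} R = (ϖ)` for an irreducible `ϖ` of `R₀`. -/
theorem map_maximalIdeal_eq_span {ϖ : R₀} (hϖ : Irreducible ϖ) :
    (maximalIdeal R₀).map (algebraMap R₀ R) = Ideal.span {algebraMap R₀ R ϖ} := by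
  rw [hϖ.maximalIdeal_eq, Ideal.map_span, Set.image_singleton]

/-- If `𝔭_{R₀} R = 𝔭_R` then the image of an irreducible of `R₀` is non-zero. -/
theorem algebraMap_ne_zero_of_map_eq
    (h : (maximalIdeal R₀).map (algebraMap R₀ R) = maximalIdeal R) {ϖ : R₀}
    (hϖ : Irreducible ϖ) : algebraMap R₀ R ϖ ≠ 0 := by
  intro h0
  apply IsDiscreteValuationRing.not_a_field R
  rw [← h, map_maximalIdeal_eq_span hϖ, h0, Ideal.span_singleton_eq_bot]

/-- **`e = 1` keeps a uniformiser a uniformiser**: if `𝔭_{R₀} R = 𝔭_R` then the image in `R` of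
an irreducible `ϖ` of `R₀` is irreducible in `R`. -/
theorem irreducible_algebraMap_of_map_eq
    (h : (maximalIdeal R₀).map (algebraMap R₀ R) = maximalIdeal R) {ϖ : R₀}
    (hϖ : Irreducible ϖ) : Irreducible (algebraMap R₀ R ϖ) :=
  IsDiscreteValuationRing.irreducible_of_span_eq_maximalIdeal _
    (algebraMap_ne_zero_of_map_eq h hϖ) (by rw [← h, map_maximalIdeal_eq_span hϖ])

/-- `𝔭_{R₀} R = 𝔭_R` gives ramification index `1`. -/
theorem ramificationIdx'_eq_one_of_map_eq
    (h : (maximalIdeal R₀).map (algebraMap R₀ R) = maximalIdeal R) :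
    Ideal.ramificationIdx' (maximalIdeal R₀) (maximalIdeal R) = 1 := by
  rw [← not_ne_iff, Ideal.ramificationIdx'_ne_one_iff h.le, h]
  exact not_le_of_gt (Ideal.pow_lt_self _ (IsDiscreteValuationRing.not_a_field R)
    (maximalIdeal.isMaximal R).ne_top 2 le_rfl)

/-- In a DVR every ideal lying strictly between `⊥` and `⊤`, contained in `𝔭` but not in `𝔭²`,
is `𝔭` itself. -/
theorem eq_maximalIdeal_of_le_of_not_le_sq {I : Ideal R} (hI : I ≠ ⊥) (hle : I ≤ maximalIdeal R)
    (hsq : ¬ I ≤ maximalIdeal R ^ 2) : I = maximalIdeal R := by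
  obtain ⟨ϖ, hϖ⟩ := IsDiscreteValuationRing.exists_irreducible R
  obtain ⟨n, hn⟩ := IsDiscreteValuationRing.ideal_eq_span_pow_irreducible hI hϖ
  have hn' : I = maximalIdeal R ^ n := by
    rw [hn, hϖ.maximalIdeal_eq, Ideal.span_singleton_pow]
  rcases n with _ | _ | n
  · exfalso
    rw [pow_zero, Ideal.one_eq_top] at hn'
    rw [hn'] at hle
    exact (maximalIdeal.isMaximal R).ne_top (top_le_iff.mp hle)
  · rw [hn', pow_one]
  · exfalso
    apply hsq
    rw [hn']
    exact Ideal.pow_le_pow_right (by omega)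

/-- Ramification index `1` gives `𝔭_{R₀} R = 𝔭_R` (for `𝔭_{R₀} R ≠ ⊥` and `𝔭_{R₀} R ≤ 𝔭_R`). -/
theorem map_eq_of_ramificationIdx'_eq_one
    (hne : (maximalIdeal R₀).map (algebraMap R₀ R) ≠ ⊥)
    (hle : (maximalIdeal R₀).map (algebraMap R₀ R) ≤ maximalIdeal R)
    (he : Ideal.ramificationIdx' (maximalIdeal R₀) (maximalIdeal R) = 1) :
    (maximalIdeal R₀).map (algebraMap R₀ R) = maximalIdeal R := by
  refine eq_maximalIdeal_of_le_of_not_le_sq hne hle ?_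
  rw [← Ideal.ramificationIdx'_ne_one_iff hle]
  exact fun h => h he

/-- **`e = 1` ⇒ a uniformiser of `R₀` is a uniformiser of `R`** (ramification-index form). -/
theorem irreducible_algebraMap_of_ramificationIdx'_eq_one
    (hne : (maximalIdeal R₀).map (algebraMap R₀ R) ≠ ⊥)
    (hle : (maximalIdeal R₀).map (algebraMap R₀ R) ≤ maximalIdeal R)
    (he : Ideal.ramificationIdx' (maximalIdeal R₀) (maximalIdeal R) = 1) {ϖ : R₀}
    (hϖ : Irreducible ϖ) : Irreducible (algebraMap R₀ R ϖ) :=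
  irreducible_algebraMap_of_map_eq (map_eq_of_ramificationIdx'_eq_one hne hle he) hϖ

omit [IsDomain R] [IsDiscreteValuationRing R] in
/-- `𝔭_{R₀} R ≠ ⊥` when the structure map is injective. -/
theorem map_maximalIdeal_ne_bot (hinj : Function.Injective (algebraMap R₀ R)) :
    (maximalIdeal R₀).map (algebraMap R₀ R) ≠ ⊥ := by
  rw [Ne, Ideal.map_eq_bot_iff_of_injective hinj]
  exact IsDiscreteValuationRing.not_a_field R₀

/-- `𝔭_{R₀} R ≤ 𝔭_R` when `𝔭_{R₀} R` is proper. -/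
theorem map_maximalIdeal_le (hne : (maximalIdeal R₀).map (algebraMap R₀ R) ≠ ⊤) :
    (maximalIdeal R₀).map (algebraMap R₀ R) ≤ maximalIdeal R :=
  le_maximalIdeal hne

end DVR

section IntegralClosure

variable (R₀ F E : Type*) [CommRing R₀] [IsDomain R₀] [IsDiscreteValuationRing R₀] [Field F]
  [Field E] [Algebra R₀ F] [IsFractionRing R₀ F] [Algebra F E] [Algebra R₀ E]
  [IsScalarTower R₀ F E]

omit [IsDomain R₀] [IsDiscreteValuationRing R₀] in
include F in
/-- The structure map `R₀ → E` is injective. -/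
theorem algebraMap_injective : Function.Injective (algebraMap R₀ E) := by
  rw [IsScalarTower.algebraMap_eq R₀ F E]
  exact (algebraMap F E).injective.comp (IsFractionRing.injective R₀ F)

include F in
/-- The integral closure of a DVR `R₀` in an extension `E` of its fraction field is not a field:
the inverse of a uniformiser of `R₀` is not integral (`R₀` is integrally closed). -/
theorem not_isField_integralClosure : ¬ IsField (integralClosure R₀ E) := by
  intro hf
  obtain ⟨ϖ, hϖ⟩ := IsDiscreteValuationRing.exists_irreducible R₀
  have hne : algebraMap R₀ F ϖ ≠ 0 :=
    (map_ne_zero_iff _ (IsFractionRing.injective R₀ F)).mpr hϖ.ne_zero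
  set c : integralClosure R₀ E := ⟨algebraMap R₀ E ϖ, isIntegral_algebraMap⟩ with hc
  have hc0 : c ≠ 0 := by
    intro h
    apply hϖ.ne_zero
    apply algebraMap_injective R₀ F E
    rw [map_zero]
    exact congrArg Subtype.val h
  obtain ⟨d, hd⟩ := hf.mul_inv_cancel hc0
  have h1 : (c : E) * d = 1 := congrArg Subtype.val hd
  have hcE : (c : E) = algebraMap F E (algebraMap R₀ F ϖ) := IsScalarTower.algebraMap_apply R₀ F E ϖ
  have hd' : (d : E) = algebraMap F E (algebraMap R₀ F ϖ)⁻¹ := by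
    rw [map_inv₀]
    rw [hcE] at h1
    exact eq_inv_of_mul_eq_one_right h1
  have hint : IsIntegral R₀ (algebraMap R₀ F ϖ)⁻¹ := by
    have hdi := d.2
    rw [mem_integralClosure_iff, hd'] at hdi
    exact (isIntegral_algebraMap_iff (algebraMap F E).injective).mp hdi
  obtain ⟨y, hy⟩ := IsIntegrallyClosed.isIntegral_iff.mp hint
  apply hϖ.not_isUnit
  refine isUnit_iff_exists_inv.mpr ⟨y, ?_⟩
  apply IsFractionRing.injective R₀ F
  rw [map_mul, hy, map_one, mul_inv_cancel₀ hne]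

include F in
/-- **The ring of integers is a DVR as soon as it is local**: for a DVR `R₀` with fraction
field `F` and a finite separable extension `E / F`, the integral closure of `R₀` in `E` is a
Dedekind domain (Mathlib), hence a DVR when it is a local ring. -/
theorem isDiscreteValuationRing_integralClosure [FiniteDimensional F E]
    [Algebra.IsSeparable F E] [IsLocalRing (integralClosure R₀ E)] :
    IsDiscreteValuationRing (integralClosure R₀ E) := by
  haveI : IsDedekindDomain (integralClosure R₀ E) := integralClosure.isDedekindDomain R₀ F E
  exact ((IsDiscreteValuationRing.TFAE (integralClosure R₀ E)
    (not_isField_integralClosure R₀ F E)).out 0 2).mpr this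

end IntegralClosure

end Summit.Ventures.HodgeRepro2.T5UnramifiedUniformiser
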